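import Mathlib
import Literature.Analysis.FluidPDE.VectorCalculus

/-!
# crux CoreGluingGivenInvertibilityQR, line Sketch, stub stub_qrAxisHeadIdentity — rotating-frame Bernoulli law

The exact energy identity ("the Coriolis force does no work") behind the axis-head estimate of the
forced, rotated Leray profile equation
`α(e₃×U − DU[e₃×y]) + ½U + ½DU[y] − ΔU + DU[U] + ∇P = F` on `ℝ³ = EuclideanSpace ℝ (Fin 3)`:
with the frame velocity `W = U + ½y − α e₃×y` and the head
`H = ½|W|² + P − |y|²/8 − ½α²(y₀² + y₁²)` one has, pointwise, `⟪W, ∇H⟫ = ⟪W, ΔU + F⟫`.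

Proof: compute `∇H` by the chain rule (`HasFDerivAt.norm_sq`, `PiLp.hasFDerivAt_apply`), substitute
`F` from the equation, and check the remaining polynomial identity in coordinates (`ring`).
-/

set_option linter.dupNamespace false

noncomputable section

namespace Summit.NavierStokesRegularity.NavierStokesRegularity.Theorems

open MeasureTheory Real Set Filter Topology
open scoped InnerProductSpace
open Literature.Analysis.FluidPDE

/-- First coordinate of the cross product on `EuclideanSpace ℝ (Fin 3)`. [folklore] -/
private theorem qrAxisHead_cross_apply_zero (u v : EuclideanSpace ℝ (Fin 3)) :
    cross u v 0 = u 1 * v 2 - u 2 * v 1 := by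
  simp [cross, cross_apply]

/-- Second coordinate of the cross product on `EuclideanSpace ℝ (Fin 3)`. [folklore] -/
private theorem qrAxisHead_cross_apply_one (u v : EuclideanSpace ℝ (Fin 3)) :
    cross u v 1 = u 2 * v 0 - u 0 * v 2 := by
  simp [cross, cross_apply]

/-- Third coordinate of the cross product on `EuclideanSpace ℝ (Fin 3)`. [folklore] -/
private theorem qrAxisHead_cross_apply_two (u v : EuclideanSpace ℝ (Fin 3)) :
    cross u v 2 = u 0 * v 1 - u 1 * v 0 := by
  simp [cross, cross_apply]

/-- Coordinate formula for the real inner product of `EuclideanSpace ℝ (Fin 3)`. [folklore] -/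
private theorem qrAxisHead_inner_three (x y : EuclideanSpace ℝ (Fin 3)) :
    ⟪x, y⟫_ℝ = x 0 * y 0 + x 1 * y 1 + x 2 * y 2 := by
  rw [EuclideanSpace.inner_eq_star_dotProduct, star_trivial, dotProduct, Fin.sum_univ_three]
  ring

/-- The linear map `z ↦ e × z` is its own Fréchet derivative. [folklore] -/
private theorem qrAxisHead_hasFDerivAt_cross (e y : EuclideanSpace ℝ (Fin 3)) :
    HasFDerivAt (fun z : EuclideanSpace ℝ (Fin 3) => cross e z) (crossCLM e) y :=
  (crossCLM e).hasFDerivAt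

/-- `D(‖z‖² / 8)(y) = ⟪y, ·⟫ / 4`, as a Fréchet derivative. [folklore] -/
private theorem qrAxisHead_hasFDerivAt_norm_sq_div (y : EuclideanSpace ℝ (Fin 3)) :
    HasFDerivAt (fun z : EuclideanSpace ℝ (Fin 3) => ‖z‖ ^ 2 / 8)
      ((8 : ℝ)⁻¹ • ((2 : ℕ) • innerSL ℝ y)) y := by
  have h := (hasStrictFDerivAt_norm_sq y).hasFDerivAt.mul_const (8 : ℝ)⁻¹
  exact h.congr_of_eventuallyEq (Filter.Eventually.of_forall fun z => by simp [div_eq_mul_inv])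

/-- `D(z ↦ zᵢ)(y) = (z ↦ zᵢ)` on `EuclideanSpace ℝ (Fin 3)`. [folklore] -/
private theorem qrAxisHead_hasFDerivAt_coord (y : EuclideanSpace ℝ (Fin 3)) (i : Fin 3) :
    HasFDerivAt (fun z : EuclideanSpace ℝ (Fin 3) => z i) (PiLp.proj (𝕜 := ℝ) 2 (fun _ : Fin 3 => ℝ) i) y :=
  PiLp.hasFDerivAt_apply 2 y i

/-- **Axis head identity (rotating-frame Bernoulli law of the TR_R profile equation).** If `(U, P)` solve
`α(e₃×U − DU[e₃×y]) + ½U + ½DU[y] − ΔU + DU[U] + ∇P = F`, then with the frame velocity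
`W = U + ½y − α e₃×y` and the head `H = ½|W|² + P − |y|²/8 − ½α²(y₀² + y₁²)` one has pointwise
`⟪W, ∇H⟫ = ⟪W, ΔU + F⟫` (the equation is `W·∇W + 2α e₃×W + ∇(P − |y|²/8 − ½α²|y_h|²) = ΔU + F`
and the Coriolis force does no work). [folklore] -/
theorem stub_qrAxisHeadIdentity :
    ∀ (α : ℝ) (U F : EuclideanSpace ℝ (Fin 3) → EuclideanSpace ℝ (Fin 3)) (P : EuclideanSpace ℝ (Fin 3) → ℝ),
      ContDiff ℝ 2 U → ContDiff ℝ 1 P →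
      (∀ y, α • (cross (EuclideanSpace.single 2 1) (U y) - fderiv ℝ U y (cross (EuclideanSpace.single 2 1) y))
          + (1/2 : ℝ) • U y + (1/2 : ℝ) • fderiv ℝ U y y - (Laplacian.laplacian U) y + fderiv ℝ U y (U y)
          + gradient P y = F y) →
      ∀ y, ⟪U y + (1/2 : ℝ) • y - α • cross (EuclideanSpace.single 2 1) y,
            gradient (fun z => (1/2 : ℝ) * ‖U z + (1/2 : ℝ) • z - α • cross (EuclideanSpace.single 2 1) z‖ ^ 2
              + P z - ‖z‖ ^ 2 / 8 - (1/2 : ℝ) * α ^ 2 * (z 0 ^ 2 + z 1 ^ 2)) y⟫_ℝ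
          = ⟪U y + (1/2 : ℝ) • y - α • cross (EuclideanSpace.single 2 1) y,
              (Laplacian.laplacian U) y + F y⟫_ℝ := by
  intro α U F P hU hP hPDE y
  set e : EuclideanSpace ℝ (Fin 3) := EuclideanSpace.single 2 1 with he
  have he0 : e 0 = 0 := by simp [he]
  have he1 : e 1 = 0 := by simp [he]
  have he2 : e 2 = 1 := by simp [he]
  -- the Fréchet derivatives at `y` of the four summands of the head `H`
  have hUd : HasFDerivAt U (fderiv ℝ U y) y := ((hU.differentiable (by norm_num)) y).hasFDerivAt
  have hPd : HasFDerivAt P ((InnerProductSpace.toDual ℝ (EuclideanSpace ℝ (Fin 3))) (gradient P y)) y :=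
    (((hP.differentiable (by norm_num)) y).hasGradientAt).hasFDerivAt
  have hW : HasFDerivAt (fun z : EuclideanSpace ℝ (Fin 3) => U z + (1/2 : ℝ) • z - α • cross e z)
      (fderiv ℝ U y + (1/2 : ℝ) • ContinuousLinearMap.id ℝ (EuclideanSpace ℝ (Fin 3))
        - α • crossCLM e) y :=
    (hUd.fun_add ((hasFDerivAt_id y).fun_const_smul (1/2 : ℝ))).fun_sub
      ((qrAxisHead_hasFDerivAt_cross e y).fun_const_smul α)
  have hA : HasFDerivAt
      (fun z : EuclideanSpace ℝ (Fin 3) => (1/2 : ℝ) * ‖U z + (1/2 : ℝ) • z - α • cross e z‖ ^ 2)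
      ((1/2 : ℝ) • ((2 : ℕ) • (innerSL ℝ (U y + (1/2 : ℝ) • y - α • cross e y)).comp
        (fderiv ℝ U y + (1/2 : ℝ) • ContinuousLinearMap.id ℝ (EuclideanSpace ℝ (Fin 3))
          - α • crossCLM e))) y :=
    hW.norm_sq.const_mul (1/2 : ℝ)
  have hB : HasFDerivAt
      (fun z : EuclideanSpace ℝ (Fin 3) => (1/2 : ℝ) * α ^ 2 * (z 0 ^ 2 + z 1 ^ 2))
      (((1/2 : ℝ) * α ^ 2) •
        (((2 : ℕ) • y 0 ^ (2 - 1)) • PiLp.proj (𝕜 := ℝ) 2 (fun _ : Fin 3 => ℝ) 0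
          + ((2 : ℕ) • y 1 ^ (2 - 1)) • PiLp.proj (𝕜 := ℝ) 2 (fun _ : Fin 3 => ℝ) 1)) y :=
    (((qrAxisHead_hasFDerivAt_coord y 0).pow 2).add
      ((qrAxisHead_hasFDerivAt_coord y 1).pow 2)).const_mul ((1/2 : ℝ) * α ^ 2)
  have hH : HasFDerivAt (fun z : EuclideanSpace ℝ (Fin 3) =>
      (1/2 : ℝ) * ‖U z + (1/2 : ℝ) • z - α • cross e z‖ ^ 2 + P z - ‖z‖ ^ 2 / 8
        - (1/2 : ℝ) * α ^ 2 * (z 0 ^ 2 + z 1 ^ 2)) _ y :=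
    ((hA.fun_add hPd).fun_sub (qrAxisHead_hasFDerivAt_norm_sq_div y)).fun_sub hB
  rw [hH.hasGradientAt.gradient]
  conv_lhs => rw [real_inner_comm, InnerProductSpace.toDual_symm_apply]
  rw [← hPDE y]
  simp only [_root_.add_apply, _root_.sub_apply, _root_.smul_apply, ContinuousLinearMap.coe_comp,
    Function.comp_apply, innerSL_apply_apply, ContinuousLinearMap.coe_id', id_eq, crossCLM_apply,
    PiLp.proj_apply, InnerProductSpace.toDual_apply_apply, map_add, map_sub, map_smul]
  generalize fderiv ℝ U y (U y) = a
  generalize fderiv ℝ U y y = b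
  generalize fderiv ℝ U y (cross e y) = c
  generalize gradient P y = p
  generalize (Laplacian.laplacian U) y = l
  generalize U y = u
  simp only [qrAxisHead_inner_three, PiLp.add_apply, PiLp.sub_apply, PiLp.smul_apply, smul_eq_mul,
    nsmul_eq_mul, qrAxisHead_cross_apply_zero, qrAxisHead_cross_apply_one,
    qrAxisHead_cross_apply_two, he0, he1, he2]
  ring

end Summit.NavierStokesRegularity.NavierStokesRegularity.Theorems
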